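import Summits.SmoothPoincare4.SmoothPoincare4.Theorems.SymplecticOrigamiOrigamiFoldExistenceStubPleatFreeStandardSheets
import Literature.Topology.FourManifolds.HomotopyS4CompactProofs

/-!
# Stub `stub_pleatFreeStandard` of line `shadow-pleats` for crux `OrigamiFoldExistence` — IV: assembly
(item stmt-SmoothPoincare4-7844, route route-SmoothPoincare4-SymplecticOrigami; line lead seat c3)

Last of four files proving the registered stub `stub_pleatFreeStandard` (PLEAT-FREE ⇒ STANDARD):
a homotopy `4`-sphere `M` admitting a `0`-pleat round-rim shadow position
(`HasPleatedPosition M 0`, tree vocabulary of `…ShadowPleatsDefs`) is diffeomorphic to the round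
sphere `S⁴ ⊂ ℝ⁵`.  Files I–III (`…StubPleatFreeStandardShadow`, `…Seam`, `…Sheets`) supply the
shadow geometry (`polarLift`, `straighten`, the inverse function theorem), the seam analysis
(the shadow `proj5 ∘ ι` is immersive at every point of positive height) and the sheet count
(`existsUnique_preimage`: above the plane `h = 1 - δ`, `M` is ONE graph over the open ball of
radius `ρ = √(1 - (1 - δ)²)`).  Here they are assembled:

* the STRAIGHTENING map `Ψ = straighten ι δ : M → ℝ⁵` (`ι` on and below the plane, the polar
  lift of the shadow above it) equals `polarLift ∘ proj5 ∘ ι` on the open set `{h > 0}` and `ι`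
  on the open set `{h < 1 - δ}`; these two open sets cover `M`, so `Ψ` is `C^∞`
  (`contMDiff_straighten`), lands in `S⁴` (`straighten_mem_sphere`), and has injective
  differential everywhere (`injective_mfderiv_straighten`: its shadow is the shadow of `ι`);
* `Ψ` is injective (sheet count above the plane, the embedding below, heights in the mixed
  case) and maps onto `S⁴` (round clause below the plane, sheet count above);
* the corestriction `M → S⁴` is therefore a bijective local diffeomorphism between `4`-manifolds
  (inverse function theorem), i.e. a diffeomorphism (`IsLocalDiffeomorph.diffeomorphOfBijective`).

Compactness of `M` (used by the sheet count) is the tree fact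
`Literature.Topology.FourManifolds.compactSpace_of_homotopyEquiv_sphere_four_holds`
(Hatcher 2002, Prop. 3.29 + Cor. 2.14).

Sources: J. M. Lee, *Introduction to Smooth Manifolds* (2013), Thm 4.5, Prop. 4.8
[LeeSmoothManifolds2013]; the planner's proof sketch in the skeleton docstring of
`stub_pleatFreeStandard` (Cruxes/OrigamiFoldExistence/Lines/shadow_pleats.lean).
-/

noncomputable section

-- the prescribed namespace `Summit.<P>.<Sub>.…` duplicates `SmoothPoincare4` (P = Sub)
set_option linter.dupNamespace false

open scoped Manifold ContDiff Topology RealInnerProductSpace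
open Set Function Filter Metric ContinuousMap

namespace Summit.SmoothPoincare4.SmoothPoincare4.Theorems.OrigamiFoldExistence.ShadowPleats

section ZeroPleat

variable {M : Type} [TopologicalSpace M] [ChartedSpace (EuclideanSpace ℝ (Fin 4)) M]
  {ι : M → EuclideanSpace ℝ (Fin 5)} {δ : ℝ}

/-! ### The straightening map on the two open pieces `{h > 0}` and `{h < 1 - δ}` -/

omit [TopologicalSpace M] [ChartedSpace (EuclideanSpace ℝ (Fin 4)) M] in
/-- On the open piece `{h > 0}` the straightening map is the polar lift of the shadow (above the
plane by definition; between the equator and the plane because `ι` lies on the upper hemisphere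
there). -/
theorem straighten_eq_polarLift_of_pos
    (hround : Set.range ι ∩ {p : EuclideanSpace ℝ (Fin 5) | p 4 ≤ 1 - δ} =
      (Metric.sphere (0 : EuclideanSpace ℝ (Fin 5)) 1 : Set (EuclideanSpace ℝ (Fin 5))) ∩
        {p : EuclideanSpace ℝ (Fin 5) | p 4 ≤ 1 - δ})
    {m : M} (hpos : 0 < ι m 4) : straighten ι δ m = polarLift (proj5 (ι m)) := by
  by_cases h : 1 - δ < ι m 4
  · exact straighten_of_lt h
  · rw [straighten_of_le (not_lt.1 h), polarLift_proj5 (mem_sphere_of_apply_le hround (not_lt.1 h))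
      hpos.le]

omit [TopologicalSpace M] [ChartedSpace (EuclideanSpace ℝ (Fin 4)) M] in
/-- The radius `ρ = √(1 - (1 - δ)²)` of the polar circle is `< 1`. -/
theorem rho_lt_one (hδ1 : δ < 1) : Real.sqrt (1 - (1 - δ) ^ 2) < 1 := by
  rw [Real.sqrt_lt' one_pos]
  nlinarith

omit [TopologicalSpace M] [ChartedSpace (EuclideanSpace ℝ (Fin 4)) M] in
/-- Above the plane, the polar lift of a shadow of norm `< ρ` has height `> 1 - δ`. -/
theorem lt_polarLift_apply_four (hδ1 : δ < 1) {x : EuclideanSpace ℝ (Fin 4)}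
    (hx : ‖x‖ < Real.sqrt (1 - (1 - δ) ^ 2)) : 1 - δ < polarLift x 4 := by
  rw [polarLift_apply_four, Real.lt_sqrt (by linarith)]
  have := (Real.lt_sqrt (norm_nonneg x)).1 hx
  linarith

omit [TopologicalSpace M] [ChartedSpace (EuclideanSpace ℝ (Fin 4)) M] in
/-- A point of the sphere strictly above the plane has shadow of norm `< ρ`. -/
theorem norm_proj5_lt_of_lt (hδ1 : δ < 1) {p : EuclideanSpace ℝ (Fin 5)}
    (hp : p ∈ Metric.sphere (0 : EuclideanSpace ℝ (Fin 5)) 1) (h4 : 1 - δ < p 4) :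
    ‖proj5 p‖ < Real.sqrt (1 - (1 - δ) ^ 2) := by
  rw [Real.lt_sqrt (norm_nonneg _), norm_proj5_sq_of_mem_sphere hp]
  nlinarith

variable [IsManifold (𝓡 4) ∞ M]

/-- On the open piece `{h > 0}` the shadow lies in the OPEN unit ball (maximum principle above the
plane, sphere geometry below it), where the polar lift is smooth. -/
theorem norm_shadow_lt_one [CompactSpace M] (hι : Manifold.IsSmoothEmbedding (𝓡 4) (𝓡 5) ∞ ι)
    (hδ : 0 < δ) (hδ1 : δ < 1)
    (hround : Set.range ι ∩ {p : EuclideanSpace ℝ (Fin 5) | p 4 ≤ 1 - δ} =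
      (Metric.sphere (0 : EuclideanSpace ℝ (Fin 5)) 1 : Set (EuclideanSpace ℝ (Fin 5))) ∩
        {p : EuclideanSpace ℝ (Fin 5) | p 4 ≤ 1 - δ})
    (hinj : ∀ m : M, 1 - δ < ι m 4 → Injective (mfderiv (𝓡 4) (𝓡 4) (proj5 ∘ ι) m))
    {m : M} (hpos : 0 < ι m 4) : ‖proj5 (ι m)‖ < 1 := by
  by_cases h : 1 - δ < ι m 4
  · exact (norm_shadow_lt hι hδ hδ1 hround hinj h).trans (rho_lt_one hδ1)
  · have hsq : ‖proj5 (ι m)‖ ^ 2 = 1 - (ι m 4) ^ 2 :=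
      norm_proj5_sq_of_mem_sphere (mem_sphere_of_apply_le hround (not_lt.1 h))
    refine lt_of_pow_lt_pow_left₀ 2 zero_le_one ?_
    rw [one_pow, hsq]
    nlinarith

/-- **The straightening map is smooth** (as a map into `ℝ⁵`): on the open piece `{h < 1 - δ}` it
is `ι`, on the open piece `{h > 0}` it is the polar lift (smooth on the open unit ball) of the
smooth shadow, and the two pieces cover `M` because `0 < 1 - δ`. -/
theorem contMDiff_straighten [CompactSpace M] (hι : Manifold.IsSmoothEmbedding (𝓡 4) (𝓡 5) ∞ ι)
    (hδ : 0 < δ) (hδ1 : δ < 1)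
    (hround : Set.range ι ∩ {p : EuclideanSpace ℝ (Fin 5) | p 4 ≤ 1 - δ} =
      (Metric.sphere (0 : EuclideanSpace ℝ (Fin 5)) 1 : Set (EuclideanSpace ℝ (Fin 5))) ∩
        {p : EuclideanSpace ℝ (Fin 5) | p 4 ≤ 1 - δ})
    (hinj : ∀ m : M, 1 - δ < ι m 4 → Injective (mfderiv (𝓡 4) (𝓡 4) (proj5 ∘ ι) m)) :
    ContMDiff (𝓡 4) (𝓡 5) ∞ (straighten ι δ) := by
  intro m
  by_cases hpos : 0 < ι m 4
  · have hopen : IsOpen {m' : M | 0 < ι m' 4} := isOpen_lt continuous_const (continuous_height hι)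
    have hev : straighten ι δ =ᶠ[𝓝 m] polarLift ∘ (proj5 ∘ ι) :=
      Filter.eventually_of_mem (hopen.mem_nhds hpos) fun m' hm' =>
        straighten_eq_polarLift_of_pos hround hm'
    refine ContMDiffAt.congr_of_eventuallyEq ?_ hev
    exact ContDiffAt.comp_contMDiffAt (f := proj5 ∘ ι) (x := m)
      (contDiffAt_polarLift (norm_shadow_lt_one hι hδ hδ1 hround hinj hpos)) (contMDiff_shadow hι m)
  · have hlt : ι m 4 < 1 - δ := by linarith [not_lt.1 hpos]
    have hopen : IsOpen {m' : M | ι m' 4 < 1 - δ} :=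
      isOpen_lt (continuous_height hι) continuous_const
    have hev : straighten ι δ =ᶠ[𝓝 m] ι :=
      Filter.eventually_of_mem (hopen.mem_nhds hlt) fun m' hm' => straighten_of_le (le_of_lt hm')
    exact (hι.contMDiff m).congr_of_eventuallyEq hev

/-- **The straightening map lands in the round sphere.** -/
theorem straighten_mem_sphere [CompactSpace M] (hι : Manifold.IsSmoothEmbedding (𝓡 4) (𝓡 5) ∞ ι)
    (hδ : 0 < δ) (hδ1 : δ < 1)
    (hround : Set.range ι ∩ {p : EuclideanSpace ℝ (Fin 5) | p 4 ≤ 1 - δ} =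
      (Metric.sphere (0 : EuclideanSpace ℝ (Fin 5)) 1 : Set (EuclideanSpace ℝ (Fin 5))) ∩
        {p : EuclideanSpace ℝ (Fin 5) | p 4 ≤ 1 - δ})
    (hinj : ∀ m : M, 1 - δ < ι m 4 → Injective (mfderiv (𝓡 4) (𝓡 4) (proj5 ∘ ι) m)) (m : M) :
    straighten ι δ m ∈ Metric.sphere (0 : EuclideanSpace ℝ (Fin 5)) 1 := by
  by_cases h : 1 - δ < ι m 4
  · rw [straighten_of_lt h]
    exact polarLift_mem_sphere (norm_shadow_lt_one hι hδ hδ1 hround hinj (by linarith)).le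
  · rw [straighten_of_le (not_lt.1 h)]
    exact mem_sphere_of_apply_le hround (not_lt.1 h)

/-- **The straightening map is an immersion**: its shadow `proj5 ∘ straighten ι δ = proj5 ∘ ι` is
immersive at every point of positive height (file II), and on `{h ≤ 0}` it is locally `ι`. -/
theorem injective_mfderiv_straighten [CompactSpace M]
    (hι : Manifold.IsSmoothEmbedding (𝓡 4) (𝓡 5) ∞ ι) (hδ : 0 < δ) (hδ1 : δ < 1)
    (hround : Set.range ι ∩ {p : EuclideanSpace ℝ (Fin 5) | p 4 ≤ 1 - δ} =
      (Metric.sphere (0 : EuclideanSpace ℝ (Fin 5)) 1 : Set (EuclideanSpace ℝ (Fin 5))) ∩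
        {p : EuclideanSpace ℝ (Fin 5) | p 4 ≤ 1 - δ})
    (hinj : ∀ m : M, 1 - δ < ι m 4 → Injective (mfderiv (𝓡 4) (𝓡 4) (proj5 ∘ ι) m)) (m : M) :
    Injective (mfderiv (𝓡 4) (𝓡 5) (straighten ι δ) m) := by
  by_cases hpos : 0 < ι m 4
  · -- chain rule: `d(proj5 ∘ ι) = d(proj5 ∘ Ψ) = proj5L ∘ dΨ`, and the left side is injective
    have hΨ : HasMFDerivAt (𝓡 4) (𝓡 5) (straighten ι δ) m
        (mfderiv (𝓡 4) (𝓡 5) (straighten ι δ) m) :=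
      ((contMDiff_straighten hι hδ hδ1 hround hinj m).mdifferentiableAt (by simp)).hasMFDerivAt
    have hproj : HasMFDerivAt 𝓘(ℝ, EuclideanSpace ℝ (Fin 5)) 𝓘(ℝ, EuclideanSpace ℝ (Fin 4))
        (proj5L : EuclideanSpace ℝ (Fin 5) → EuclideanSpace ℝ (Fin 4)) (straighten ι δ m) proj5L :=
      proj5L.hasMFDerivAt
    have hcomp := (hproj.comp m hΨ).mfderiv
    have hfun : (proj5L : EuclideanSpace ℝ (Fin 5) → EuclideanSpace ℝ (Fin 4)) ∘ straighten ι δ =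
        proj5 ∘ ι := by
      rw [coe_proj5L]
      exact proj5_comp_straighten
    rw [hfun] at hcomp
    have hsh := injective_mfderiv_shadow_of_pos hι hδ hδ1 hround hinj hpos
    rw [hcomp] at hsh
    intro v₁ v₂ h
    apply hsh
    change proj5L (mfderiv (𝓡 4) (𝓡 5) (straighten ι δ) m v₁) =
      proj5L (mfderiv (𝓡 4) (𝓡 5) (straighten ι δ) m v₂)
    rw [h]
  · have hlt : ι m 4 < 1 - δ := by linarith [not_lt.1 hpos]
    have hopen : IsOpen {m' : M | ι m' 4 < 1 - δ} :=
      isOpen_lt (continuous_height hι) continuous_const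
    have hev : straighten ι δ =ᶠ[𝓝 m] ι :=
      Filter.eventually_of_mem (hopen.mem_nhds hlt) fun m' hm' => straighten_of_le (le_of_lt hm')
    rw [hev.mfderiv_eq]
    exact injective_mfderiv_of_emb hι m

/-- **The straightening map is injective**: two points above the plane with the same image have
the same shadow, of norm `< ρ`, hence coincide by the sheet count; two points on or below the
plane are separated by the embedding `ι`; and a point above the plane is sent strictly above the
plane while a point on or below it stays there. -/
theorem injective_straighten [CompactSpace M] [T2Space M]
    (hι : Manifold.IsSmoothEmbedding (𝓡 4) (𝓡 5) ∞ ι) (hδ : 0 < δ) (hδ1 : δ < 1)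
    (hround : Set.range ι ∩ {p : EuclideanSpace ℝ (Fin 5) | p 4 ≤ 1 - δ} =
      (Metric.sphere (0 : EuclideanSpace ℝ (Fin 5)) 1 : Set (EuclideanSpace ℝ (Fin 5))) ∩
        {p : EuclideanSpace ℝ (Fin 5) | p 4 ≤ 1 - δ})
    (hinj : ∀ m : M, 1 - δ < ι m 4 → Injective (mfderiv (𝓡 4) (𝓡 4) (proj5 ∘ ι) m)) :
    Injective (straighten ι δ) := by
  intro a b hab
  have hshadow : proj5 (ι a) = proj5 (ι b) := by
    rw [← proj5_straighten a, ← proj5_straighten b, hab]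
  by_cases ha : 1 - δ < ι a 4 <;> by_cases hb : 1 - δ < ι b 4
  · obtain ⟨m₁, -, -, huniq⟩ :=
      existsUnique_preimage hι hδ hδ1 hround hinj (norm_shadow_lt hι hδ hδ1 hround hinj hb)
    exact (huniq a ha hshadow).trans (huniq b hb rfl).symm
  · exfalso
    have h4 := congrArg (fun q : EuclideanSpace ℝ (Fin 5) => q 4) hab
    simp only [straighten_of_lt ha, straighten_of_le (not_lt.1 hb)] at h4
    have := lt_polarLift_apply_four hδ1 (norm_shadow_lt hι hδ hδ1 hround hinj ha)
    linarith [not_lt.1 hb]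
  · exfalso
    have h4 := congrArg (fun q : EuclideanSpace ℝ (Fin 5) => q 4) hab
    simp only [straighten_of_lt hb, straighten_of_le (not_lt.1 ha)] at h4
    have := lt_polarLift_apply_four hδ1 (norm_shadow_lt hι hδ hδ1 hround hinj hb)
    linarith [not_lt.1 ha]
  · rw [straighten_of_le (not_lt.1 ha), straighten_of_le (not_lt.1 hb)] at hab
    exact hι.isEmbedding.injective hab

/-- **The straightening map is onto the sphere**: a point of the sphere on or below the plane is
`ι m = straighten ι δ m` by the round clause; a point strictly above it has shadow of norm `< ρ`,
over which the sheet count provides a point of `M` above the plane, straightened onto it. -/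
theorem exists_straighten_eq [CompactSpace M] [T2Space M]
    (hι : Manifold.IsSmoothEmbedding (𝓡 4) (𝓡 5) ∞ ι) (hδ : 0 < δ) (hδ1 : δ < 1)
    (hround : Set.range ι ∩ {p : EuclideanSpace ℝ (Fin 5) | p 4 ≤ 1 - δ} =
      (Metric.sphere (0 : EuclideanSpace ℝ (Fin 5)) 1 : Set (EuclideanSpace ℝ (Fin 5))) ∩
        {p : EuclideanSpace ℝ (Fin 5) | p 4 ≤ 1 - δ})
    (hinj : ∀ m : M, 1 - δ < ι m 4 → Injective (mfderiv (𝓡 4) (𝓡 4) (proj5 ∘ ι) m))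
    {p : EuclideanSpace ℝ (Fin 5)} (hp : p ∈ Metric.sphere (0 : EuclideanSpace ℝ (Fin 5)) 1) :
    ∃ m : M, straighten ι δ m = p := by
  by_cases h4 : 1 - δ < p 4
  · obtain ⟨m₁, hm₁, hm₁x, -⟩ :=
      existsUnique_preimage hι hδ hδ1 hround hinj (norm_proj5_lt_of_lt hδ1 hp h4)
    refine ⟨m₁, ?_⟩
    rw [straighten_of_lt hm₁, hm₁x, polarLift_proj5 hp (by linarith)]
  · obtain ⟨m, hm⟩ := mem_range_of_mem_sphere hround hp (not_lt.1 h4)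
    refine ⟨m, ?_⟩
    rw [straighten_of_le (by rw [hm]; exact not_lt.1 h4), hm]

/-- **The corestriction `M → S⁴` of the straightening map has injective differential**: composing
with the inclusion `S⁴ ↪ ℝ⁵` (chain rule) gives the injective differential of `straighten ι δ`. -/
theorem injective_mfderiv_codRestrict_straighten [CompactSpace M]
    (hι : Manifold.IsSmoothEmbedding (𝓡 4) (𝓡 5) ∞ ι) (hδ : 0 < δ) (hδ1 : δ < 1)
    (hround : Set.range ι ∩ {p : EuclideanSpace ℝ (Fin 5) | p 4 ≤ 1 - δ} =
      (Metric.sphere (0 : EuclideanSpace ℝ (Fin 5)) 1 : Set (EuclideanSpace ℝ (Fin 5))) ∩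
        {p : EuclideanSpace ℝ (Fin 5) | p 4 ≤ 1 - δ})
    (hinj : ∀ m : M, 1 - δ < ι m 4 → Injective (mfderiv (𝓡 4) (𝓡 4) (proj5 ∘ ι) m))
    (hmem : ∀ m, straighten ι δ m ∈ Metric.sphere (0 : EuclideanSpace ℝ (Fin 5)) 1) (m : M) :
    Injective (mfderiv (𝓡 4) (𝓡 4)
      (Set.codRestrict (straighten ι δ) (Metric.sphere (0 : EuclideanSpace ℝ (Fin 5)) 1) hmem) m) := by
  set Ψ' : M → Metric.sphere (0 : EuclideanSpace ℝ (Fin 5)) 1 :=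
    Set.codRestrict (straighten ι δ) (Metric.sphere (0 : EuclideanSpace ℝ (Fin 5)) 1) hmem with hΨ'
  have hsmooth : ContMDiff (𝓡 4) (𝓡 4) ∞ Ψ' :=
    (contMDiff_straighten hι hδ hδ1 hround hinj).codRestrict_sphere hmem
  have hval : MDifferentiableAt (𝓡 4) (𝓡 5)
      (Subtype.val : Metric.sphere (0 : EuclideanSpace ℝ (Fin 5)) 1 → EuclideanSpace ℝ (Fin 5))
      (Ψ' m) :=
    (contMDiff_coe_sphere (m := ∞) (n := 4) (E := EuclideanSpace ℝ (Fin 5))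
      (Ψ' m)).mdifferentiableAt (by simp)
  have hd : MDifferentiableAt (𝓡 4) (𝓡 4) Ψ' m := (hsmooth m).mdifferentiableAt (by simp)
  have hcomp := mfderiv_comp m hval hd
  have hfun : (Subtype.val : Metric.sphere (0 : EuclideanSpace ℝ (Fin 5)) 1 →
      EuclideanSpace ℝ (Fin 5)) ∘ Ψ' = straighten ι δ := rfl
  rw [hfun] at hcomp
  have h := injective_mfderiv_straighten hι hδ hδ1 hround hinj m
  rw [hcomp] at h
  intro v₁ v₂ hv
  apply h
  change mfderiv (𝓡 4) (𝓡 5)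
      (Subtype.val : Metric.sphere (0 : EuclideanSpace ℝ (Fin 5)) 1 → EuclideanSpace ℝ (Fin 5))
      (Ψ' m) (mfderiv (𝓡 4) (𝓡 4) Ψ' m v₁) =
    mfderiv (𝓡 4) (𝓡 5)
      (Subtype.val : Metric.sphere (0 : EuclideanSpace ℝ (Fin 5)) 1 → EuclideanSpace ℝ (Fin 5))
      (Ψ' m) (mfderiv (𝓡 4) (𝓡 4) Ψ' m v₂)
  rw [hv]

end ZeroPleat

/-! ### The stub -/

/-- **STUB 6 of line `shadow-pleats` (PLEAT-FREE ⇒ STANDARD).**  A homotopy `4`-sphere `M` with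
a pleat-free round-rim shadow position (`HasPleatedPosition M 0`: a `C^∞` embedding
`ι : M ↪ ℝ⁵` whose image below the plane `h = 1 - δ` is the round unit sphere and whose shadow
`proj5 ∘ ι` is immersive above that plane) is diffeomorphic to `S⁴`.  Proof: `M` is compact
(homotopy `S⁴`, Hatcher Prop. 3.29); the straightening map `straighten ι δ` corestricted to `S⁴`
is smooth, bijective (sheet count of file III + round clause) and has injective differential
everywhere, hence is a bijective local diffeomorphism of `4`-manifolds (inverse function
theorem), hence a diffeomorphism. [cite: LeeSmoothManifolds2013, Thm. 4.5, Prop. 4.8] -/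
theorem stub_pleatFreeStandard :
    ∀ (M : Type) [TopologicalSpace M] [T2Space M] [SecondCountableTopology M]
      [ChartedSpace (EuclideanSpace ℝ (Fin 4)) M] [IsManifold (𝓡 4) ∞ M],
      M ≃ₕ (Metric.sphere (0 : EuclideanSpace ℝ (Fin 5)) 1) →
      HasPleatedPosition M 0 →
      Nonempty (M ≃ₘ⟮𝓡 4, 𝓡 4⟯ (Metric.sphere (0 : EuclideanSpace ℝ (Fin 5)) 1)) := by
  intro M _ _ _ _ _ hM hP
  obtain ⟨ι, δ, e, hι, hδ, hδ1, hround, -, -, hinj', -⟩ := hP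
  haveI : CompactSpace M :=
    Literature.Topology.FourManifolds.compactSpace_of_homotopyEquiv_sphere_four_holds M hM
  have hinj : ∀ m : M, 1 - δ < ι m 4 → Injective (mfderiv (𝓡 4) (𝓡 4) (proj5 ∘ ι) m) :=
    fun m hm => hinj' m hm (by simp)
  have hmem : ∀ m, straighten ι δ m ∈ Metric.sphere (0 : EuclideanSpace ℝ (Fin 5)) 1 :=
    straighten_mem_sphere hι hδ hδ1 hround hinj
  set Ψ' : M → Metric.sphere (0 : EuclideanSpace ℝ (Fin 5)) 1 :=
    Set.codRestrict (straighten ι δ) (Metric.sphere (0 : EuclideanSpace ℝ (Fin 5)) 1) hmem with hΨ'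
  have hsmooth : ContMDiff (𝓡 4) (𝓡 4) ∞ Ψ' :=
    (contMDiff_straighten hι hδ hδ1 hround hinj).codRestrict_sphere hmem
  have hloc : IsLocalDiffeomorph (𝓡 4) (𝓡 4) ∞ Ψ' := fun m =>
    isLocalDiffeomorphAt_of_injective_mfderiv_four hsmooth
      (injective_mfderiv_codRestrict_straighten hι hδ hδ1 hround hinj hmem m)
  have hbij : Bijective Ψ' := by
    refine ⟨fun a b hab => injective_straighten hι hδ hδ1 hround hinj ?_, fun p => ?_⟩
    · exact congrArg Subtype.val hab
    · obtain ⟨m, hm⟩ := exists_straighten_eq hι hδ hδ1 hround hinj p.2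
      exact ⟨m, Subtype.ext hm⟩
  exact ⟨hloc.diffeomorphOfBijective hbij⟩

end Summit.SmoothPoincare4.SmoothPoincare4.Theorems.OrigamiFoldExistence.ShadowPleats

end
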